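import Literature.AlgebraicGeometry.Frobenioids.PadicFrobenioid
import Literature.AlgebraicGeometry.Frobenioids.PreFrobenioidMorphisms
import Literature.AlgebraicGeometry.Frobenioids.ProfiniteUnits
import HarnessLib

/-!
# Frobenioids II, Theorem 1.2: basic properties of `p`-adic Frobenioids

Mochizuki, *The geometry of Frobenioids II*, Kyushu J. Math. **62** (2008) 401–460, §1, Theorem 1.2
(i)–(v) pp. 9–10 and Remarks 1.2.1, 1.2.2 p. 10 [cite: MochizukiFrdII2008, Thm 1.2 pp.9-10], stated for
the `p`-adic Frobenioid `C = d.frobenioid` of a `PadicFrd.Datum` (`PadicFrobenioid.lean`, monoid type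
`Λ = ℤ`) with its structure functor `C → F_Φ` and its projection `C → D → D₀` (`d.toBaseZero`).

**Vocabulary.** The [FrdI] Def. 1.2 typology is found's `PreFrobenioid.*`
(`PreFrobenioidMorphisms.lean`) applied to `d.structureFunctor`; the notions owned by sibling files
not yet landed — model type and characteristic splittings
([FrdI] Thm. 5.2 (ii) / Def. 2.3, abc-iut-L1-t2), rationally standard type ([FrdI] Def. 4.5 (iii),
abc-iut-L1-t3), and the Frobenius functors of [FrdI] Prop. 2.5 (iii) / Cor. 2.6 / Prop. 2.9 (ii) quoted
by Remark 1.2.1 — enter through the explicit record `Thm12Vocab` (TODO-merge: replace its fields by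
those declarations when they land). Since the datum has `Λ = ℤ`, the clauses of (i), (ii), (iv) about
`Λ = ℚ, ℝ` ("resp. `Λ = ℝ` … unit-trivial", "`Λ ∈ {ℤ, ℚ}`", "`Λ ∈ {ℤ, ℝ}`") specialize to their `Λ = ℤ`
instances, which are the ones typed; the standing hypothesis "`K` is a finite extension of `ℚ_p`"
(needed for (i) unit-profinite and (iv), via [FrdI] Prop. 1.13 (iii)(b)) is the datum field
`Datum.isPadicLocal`; Theorem 1.2 (ii) is typed through the IMAGE of `Aut_C(A)` in `Aut_{D₀}(A₀)`
(`d.toBaseZero.mapIso`), never through `Aut_D(A_D)` (RQ7 audit T4-F1/F2, 2026-08-25).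
SCHEMA NOTICE (RQ7 N1): the declarations taking `V : Thm12Vocab d` (`Thm12_i_types`,
`Thm12_i_standard`, `Thm12_v`, `Rmk121`) are SCHEMAS, NOT citable named facts, until the
TODO-merge binds `V`'s fields to abc-iut-L1-t2's [FrdI] Def. 2.3 / Thm. 5.2 (ii) / Prop. 2.5–2.9
declarations and abc-iut-L1-t3's Def. 4.5 (iii) (fact-claimers and the debt counter should skip them);
`Thm12_i_unitProfinite` (bound to t2's landed `AdmitsTfgProfiniteTopology`), `Thm12_ii`, `Thm12_iii`,
`Thm12_iv`, `Rmk122_twist` do not depend on `V`.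
Each roman item is one `Prop` quoting print; nothing is asserted.
-/

namespace Literature.AlgebraicGeometry.Frobenioids

open CategoryTheory Opposite Function

universe v u

namespace PadicFrd

variable {D : Type u} [Category.{v} D] {p : ℕ} [Fact p.Prime] (d : Datum D p)

/-- The standing requirement of [FrdI] Thm. 5.2 behind "the Frobenioid `C` that arises as the model
Frobenioid associated to this data" (FrdII Ex. 1.1 (ii), p. 8): `Φ` and `B` are MONOIDS ON `D` in the
sense of [FrdI] Def. 1.1 (ii) (pull-back maps characteristically injective; FSM-morphisms of `D` go to
isomorphisms — found's `IsMonoidOn`). It is automatic when `D` is of FSM-type (e.g. `D = B^temp(Π, Π°)⁰`,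
Ex. 1.3 (i)) and is recorded as a predicate on the datum, to be supplied wherever "`C` is a Frobenioid"
is used (interface note abc-iut-L1-d8, 2026-08-25). [cite: MochizukiFrdII2008, Ex 1.1 (ii) p.8] -/
def Datum.IsMonoidData : Prop := IsMonoidOn d.Φ ∧ IsMonoidOn d.B

/-- The vocabulary of Theorem 1.2 / Remark 1.2.1 owned by sibling files not yet in the tree, as explicit
predicates on the `p`-adic Frobenioid `C = d.frobenioid` (TODO-merge: [FrdI] Def. 2.3 characteristic splittings, Thm. 5.2 (ii) model type, Prop. 2.5 (iii) / Cor. 2.6 /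
Prop. 2.9 (ii) Frobenius functors — abc-iut-L1-t2; Def. 4.5 (iii) rationally standard type —
abc-iut-L1-t3). [cite: MochizukiFrdII2008, Thm 1.2 p.9] -/
structure Thm12Vocab where
  /-- "`C` is of model type" ([FrdI] Thm. 5.2 (ii)) -/
  IsOfModelType : Prop
  /-- "`C` is of rationally standard type" ([FrdI] Def. 4.5 (iii)) -/
  IsOfRationallyStandardType : Prop
  /-- "`τ` is a characteristic splitting on `C`" ([FrdI] Def. 2.3), `τ(A) ⊆ O^▷(A)` a submonoid -/
  IsCharacteristicSplitting : (∀ A : d.frobenioid, Submonoid (End A)) → Prop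
  /-- "`C` admits unit-linear Frobenius functors as in [FrdI] Prop. 2.5 (iii) [with `Λ = ℤ` there]" -/
  AdmitsUnitLinearFrobeniusFunctors : Prop
  /-- "`C` admits unit-wise Frobenius functors as in [FrdI] Cor. 2.6" -/
  AdmitsUnitwiseFrobeniusFunctorsI : Prop
  /-- "`C` admits unit-wise Frobenius functors as in [FrdI] Prop. 2.9 (ii)" -/
  AdmitsUnitwiseFrobeniusFunctorsII : Prop

variable (V : Thm12Vocab d)

/-- **Theorem 1.2 (i)**, first sentence (FrdII p. 9): "If `Λ = ℤ` (respectively, `Λ = ℝ`), then `C` is of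
unit-profinite (respectively, unit-trivial) type" — the `Λ = ℤ` case of this datum, with [FrdI] Def. 2.8 (i)
"unit-profinite type" = every `O^×(A)` "admits a profinite topology such that `O^×(A)`, equipped with this
topology, is a topologically finitely generated profinite group" (abc-iut-L1-t2's
`AdmitsTfgProfiniteTopology`, `ProfiniteUnits.lean`). NOT a schema. [cite: MochizukiFrdII2008, Thm 1.2 (i) p.9] -/
def Thm12_i_unitProfinite : Prop :=
  ∀ A : d.frobenioid, AdmitsTfgProfiniteTopology (PreFrobenioid.unitsSubgroup d.structureFunctor A)

/-- **Theorem 1.2 (i)**, second sentence (FrdII p. 9): "For arbitrary `Λ`, the Frobenioid `C` is of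
isotropic, model, `Aut`-ample, `Aut^sub`-ample, `End`-ample, and quasi-Frobenius-trivial type, but
not of group-like type." [cite: MochizukiFrdII2008, Thm 1.2 (i) p.9] -/
def Thm12_i_types : Prop :=
  PreFrobenioid.IsOfIsotropicType d.structureFunctor ∧ V.IsOfModelType ∧
    PreFrobenioid.IsOfType (PreFrobenioid.IsAutAmple d.structureFunctor) ∧
    PreFrobenioid.IsOfType (PreFrobenioid.IsAutSubAmple d.structureFunctor) ∧
    PreFrobenioid.IsOfType (PreFrobenioid.IsEndAmple d.structureFunctor) ∧
    PreFrobenioid.IsOfType (PreFrobenioid.IsQuasiFrobeniusTrivial d.structureFunctor) ∧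
    ¬ PreFrobenioid.IsOfType (PreFrobenioid.IsGroupLikeObj d.structureFunctor)

/-- **Theorem 1.2 (i)**, third sentence (FrdII p. 9): "If `D` is of FSMFF-type, then `C` is of
rationally standard type." [cite: MochizukiFrdII2008, Thm 1.2 (i) p.9] -/
def Thm12_i_standard : Prop := IsOfFSMFFType D → V.IsOfRationallyStandardType

/-- **Theorem 1.2 (ii)** (FrdII p. 9): "Let `A ∈ Ob(C)`; `A_D := Base(A)`; write `A₀ ∈ Ob(D₀)` for the image
of `A_D` in `D₀`. Then the natural action of `Aut_C(A)` on `O^⊳(A)`, `O^×(A)` factors through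
`Aut_{D₀}(A₀)`. If, moreover, `Λ ∈ {ℤ, ℚ}`, then this factorization determines a faithful action of the
image of `Aut_C(A)` in `Aut_{D₀}(A₀)` on `O^⊳(A)`, `O^×(A)`": conjugation by `α ∈ Aut_C(A)` on the
base-identity linear endomorphisms depends only on the image of `α` in `Aut_{D₀}(A₀)` (first clause),
and (here `Λ = ℤ`) automorphisms with the same action have the same image (second clause).
[cite: MochizukiFrdII2008, Thm 1.2 (ii) p.9] -/
def Thm12_ii : Prop :=
  (∀ (A : d.frobenioid) (α β : Aut A),
      d.toBaseZero.mapIso α = d.toBaseZero.mapIso β →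
        ∀ f ∈ PreFrobenioid.endSubmonoid d.structureFunctor A,
          α.hom ≫ f ≫ α.inv = β.hom ≫ f ≫ β.inv) ∧
    (∀ (A : d.frobenioid) (α β : Aut A),
      (∀ f ∈ PreFrobenioid.endSubmonoid d.structureFunctor A, α.hom ≫ f ≫ α.inv = β.hom ≫ f ≫ β.inv) →
        d.toBaseZero.mapIso α = d.toBaseZero.mapIso β)

/-- **Theorem 1.2 (iii)** (FrdII p. 9): "If `D` admits a terminal object, then `C` admits a
pseudo-terminal object." [cite: MochizukiFrdII2008, Thm 1.2 (iii) p.9] -/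
def Thm12_iii : Prop :=
  (∃ T : D, IsTerminalObj T) → ∃ T : d.frobenioid, IsPseudoTerminal T

/-- **Theorem 1.2 (iv)** (FrdII p. 9): "If `D` is slim, and `Λ ∈ {ℤ, ℝ}`, then `C` is also slim" — the
`Λ = ℤ` case. [cite: MochizukiFrdII2008, Thm 1.2 (iv) p.9] -/
def Thm12_iv : Prop := IsSlim D → IsSlim d.frobenioid

/-- **Theorem 1.2 (v)** (FrdII p. 9): "Suppose that `Φ` is absolutely primitive. Then `C` is of
base-trivial type. Moreover, the element `p ∈ ℚ_p^×` determines a characteristic splitting on `C`"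
(second clause through `Thm12Vocab.IsCharacteristicSplitting`: the splitting `τ_p(A) := ` the
submonoid generated by the base-identity endomorphism of `A` defined by `p ∈ K_A^×` is one).
[cite: MochizukiFrdII2008, Thm 1.2 (v) p.9] -/
def Thm12_v : Prop :=
  d.IsAbsolutelyPrimitive →
    PreFrobenioid.IsOfType (PreFrobenioid.IsBaseTrivial d.structureFunctor) ∧
      ∃ τ : ∀ A : d.frobenioid, Submonoid (End A), V.IsCharacteristicSplitting τ ∧
        ∀ A : d.frobenioid, ∀ f ∈ τ A, f ∈ PreFrobenioid.endSubmonoid d.structureFunctor A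

/-- **Remark 1.2.1** (FrdII p. 10): "if `Φ` is absolutely primitive, then by Theorem 1.2, (i), (v), it
follows that `C` admits unit-linear Frobenius functors as in [FrdI], Proposition 2.5, (iii) … and
unit-wise Frobenius functors as in [FrdI], Corollary 2.6. If, moreover, `Λ = ℤ`, then `C` admits
unit-wise Frobenius functors as in [FrdI], Proposition 2.9, (ii)" (through `Thm12Vocab`; `Λ = ℤ` here).
[cite: MochizukiFrdII2008, Rmk 1.2.1 p.10] -/
def Rmk121 : Prop :=
  d.IsAbsolutelyPrimitive →
    V.AdmitsUnitLinearFrobeniusFunctors ∧ V.AdmitsUnitwiseFrobeniusFunctorsI ∧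
      V.AdmitsUnitwiseFrobeniusFunctorsII

/-- **Remark 1.2.2** (FrdII p. 10) — OWN VARIANT (RQ7 N2; referee finding J5-F1, abc-iut-ref-j 2026-08-25), NOT
the printed construction and NOT a consequence of it: print builds, from a "section" `u_D` of `O^×(−)` ("i.e.,
every arrow `φ : A_D → B_D` of `D` maps `u_{B_D} ↦ u_{A_D}`"), "a new characteristic splitting '`u_D · τ`'",
"a unique automorphism `U` of the data `(Φ, B → Φ^gp)` which is the identity on `O^×(−)` … and `Φ`, but which
maps `τ` … to `u_D · τ`", and the self-equivalence "`Ψ_U : C ⥲ C`", which "exhibits an example of a situation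
where `p ∈ ℚ_p^×` is mapped to some `p · u ∈ ℚ_p^×`, where `u ∈ ℤ_p^×` — a situation which, of course, never
arises in conventional scheme theory." The printed data `(u_D, u_D · τ, U, Ψ_U)` are typed in
`PadicFrobenioidRmk122.lean` (`Datum.UnitSection`, `UnitSection.twist`, `Rmk122TwistOfBijective` = sentence 3 under
the explicit constancy reading (R1), `Rmk122R2` = the hypothesis-free reading (R2, PROVED as `rmk122R2_holds` in
`PadicFrobenioidUnitSplittings.lean`), `Rmk122UOfBijective`, `Rmk122SelfEquivalence` with
`rmk122SelfEquivalence_holds`). THIS decl is a cell-made variant with a WEAKER hypothesis (one nontrivial unit of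
one object instead of a section) and a conclusion print does not state (`Ψ ≇ 𝟭`); it is PROVED by abc-iut-L1-d8
(`rmk122_twist_holds`, `PadicFrobenioidTwistProofs.lean`) and is kept for that reason, not as a citation of
print. [cite: MochizukiFrdII2008, Rmk 1.2.2 p.10] -/
def Rmk122_twist : Prop :=
  d.IsAbsolutelyPrimitive →
    (∃ A : d.frobenioid, ∃ u ∈ PreFrobenioid.unitsSubgroup d.structureFunctor A, u ≠ 1) →
      ∃ Ψ : d.frobenioid ≌ d.frobenioid, (∀ A, (Ψ.functor.obj A).base = A.base) ∧
        IsEmpty (Ψ.functor ≅ 𝟭 d.frobenioid)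

end PadicFrd

end Literature.AlgebraicGeometry.Frobenioids
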